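import Literature.NumberTheory.Automorphic.CuspidalCohomologyGL
import Literature.NumberTheory.Automorphic.HeckeTowerCompatibility
import HarnessLib

/-!
# Change of level for twisted cohomology: pull-back, trace, `trace ∘ pull-back = [L : L']`

Topic `NumberTheory/Automorphic`; namespace `Literature.NumberTheory.Automorphic`, grouping
sub-namespace `TwistedQuotient` (as `CuspidalCohomologyGL`).

For levels `L' ≤ L ≤ 𝒢` and the twisted coefficient representations `Fun(𝒢 ⧸ L, V)`
(`TwistedQuotient.coeffRep ι L ρ`):

* `pullbackHom h : Fun(𝒢 ⧸ L, V) ⟶ Fun(𝒢 ⧸ L', V)`, `f ↦ f ∘ (𝒢 ⧸ L' → 𝒢 ⧸ L)` — a morphism of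
  `Γ`-representations (the twisted analogue of the tree's `ArithmeticQuotient.pullbackHom`), and
  `pullbackMap h q : H^q(S_L, Ṽ) ⟶ H^q(S_{L'}, Ṽ)`;
* for `[L : L']` finite, the **trace** `traceHom h : Fun(𝒢 ⧸ L', V) ⟶ Fun(𝒢 ⧸ L, V)`, summing
  over the fibres `x L / L' ≅ L / L'`, with **`pullbackHom ≫ traceHom = [L : L'] • 𝟙`**
  (`pullbackHom_comp_traceHom`); hence (`pullbackMap_injective`) **pull-back to a smaller level
  is INJECTIVE on `H^q` whenever `[L : L']` is invertible in `k`** (characteristic `0`: always);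
* Hecke compatibility (`heckeRepHom_comp_pullbackHom`, `heckeEnd_pullbackMap_apply`): when
  `𝒢 ⧸ L' → 𝒢 ⧸ L` maps `L' g L' / L'` bijectively onto `L g L / L` (levels agreeing at the
  places where `g` lives; the tree's criterion `ArithmeticQuotient.bijOn_doubleCosetQuot`),
  `T^{L'}_g ∘ pull-back = pull-back ∘ T^L_g`, on functions by the tree's
  `ArithmeticQuotient.heckeFun_comp_quotientMapOfLE`.

Use: shrinking the level at finitely many auxiliary places loses no Hecke eigenclass away from
those places (e.g. passing to a neat level, or to a level of the form `U_S × K^S`), [Harder1987,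
§1], [Shimura1971, Ch. 3, Prop. 3.1–3.3].

## References

* G. Shimura, *Introduction to the arithmetic theory of automorphic functions* (1971), Ch. 3, §3.1
  [ShimuraIATAF1971].
* G. Harder, *Eisenstein cohomology of arithmetic groups. The case GL₂*, Invent. Math. 89 (1987), §1
  [Harder1987].
-/

noncomputable section

open CategoryTheory groupCohomology

universe u

namespace Literature.NumberTheory.Automorphic

namespace TwistedQuotient

variable {k : Type u} [CommRing k] {Γ 𝒢 : Type u} [Group Γ] [Group 𝒢]
variable (ι : Γ →* 𝒢) {L L' : Subgroup 𝒢} {V : Type u} [AddCommGroup V] [Module k V]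
  (ρ : Representation k Γ V)

/-! ### Pull-back -/

/-- **Pull-back of functions along `𝒢 ⧸ L' → 𝒢 ⧸ L`** (`L' ≤ L`), a morphism
`Fun(𝒢 ⧸ L, V) ⟶ Fun(𝒢 ⧸ L', V)` of the twisted `Γ`-representations. [folklore] -/
def pullbackHom (h : L' ≤ L) : coeffRep ι L ρ ⟶ coeffRep ι L' ρ :=
  Rep.ofHom ⟨LinearMap.funLeft k V (Subgroup.quotientMapOfLE h), fun γ =>
    LinearMap.ext fun f => funext fun c => by
      change coeffRepresentation ι L ρ γ f (Subgroup.quotientMapOfLE h c) =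
        ρ γ (f (Subgroup.quotientMapOfLE h ((ι γ)⁻¹ • c)))
      rw [coeffRepresentation_apply, ArithmeticQuotient.quotientMapOfLE_smul]⟩

/-- Unfolding lemma: `(pull f)(c) = f(c̄)`. [folklore] -/
@[simp]
theorem pullbackHom_hom_apply (h : L' ≤ L) (f : (𝒢 ⧸ L) → V) (c : 𝒢 ⧸ L') :
    (pullbackHom ι ρ h).hom f c = f (Subgroup.quotientMapOfLE h c) := rfl

/-- **Pull-back in cohomology** `H^q(S_L, Ṽ) ⟶ H^q(S_{L'}, Ṽ)`. [folklore] -/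
abbrev pullbackMap (h : L' ≤ L) (q : ℕ) : cohomology ι L ρ q ⟶ cohomology ι L' ρ q :=
  groupCohomology.map (MonoidHom.id Γ) (pullbackHom ι ρ h) q

/-! ### The trace (sum over the fibres) -/

section Trace

variable (h : L' ≤ L) [(L'.subgroupOf L).FiniteIndex]

attribute [local instance] Subgroup.fintypeQuotientOfFiniteIndex

/-- The summand `f'(x l L')` as a function of `l (L' ∩ L) ∈ L ⧸ L'`. [folklore] -/
def traceTerm (f' : (𝒢 ⧸ L') → V) (x : 𝒢) : L ⧸ L'.subgroupOf L → V :=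
  Quotient.lift (fun l : L => f' ((x * (l : 𝒢) : 𝒢) : 𝒢 ⧸ L')) fun a b hab => by
    have hab' : ((a⁻¹ * b : L) : 𝒢) ∈ L' :=
      Subgroup.mem_subgroupOf.1 (QuotientGroup.leftRel_apply.1 hab)
    change f' ((x * (a : 𝒢) : 𝒢) : 𝒢 ⧸ L') = f' ((x * (b : 𝒢) : 𝒢) : 𝒢 ⧸ L')
    congr 1
    exact QuotientGroup.eq.2 (by simpa [mul_assoc] using hab')

omit [AddCommGroup V] [(L'.subgroupOf L).FiniteIndex] in
/-- Unfolding lemma. [folklore] -/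
@[simp]
theorem traceTerm_mk (f' : (𝒢 ⧸ L') → V) (x : 𝒢) (l : L) :
    traceTerm (V := V) f' x (l : L ⧸ L'.subgroupOf L) = f' ((x * (l : 𝒢) : 𝒢) : 𝒢 ⧸ L') := rfl

omit [AddCommGroup V] [(L'.subgroupOf L).FiniteIndex] in
/-- Changing the representative `x ↦ x l₀` permutes the summands. [folklore] -/
theorem traceTerm_mul (f' : (𝒢 ⧸ L') → V) (x : 𝒢) (l₀ : L) (m : L ⧸ L'.subgroupOf L) :
    traceTerm (V := V) f' (x * (l₀ : 𝒢)) m = traceTerm (V := V) f' x (l₀ • m) := by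
  induction m using QuotientGroup.induction_on with
  | H l =>
  rw [traceTerm_mk, MulAction.Quotient.smul_coe, smul_eq_mul, traceTerm_mk, Subgroup.coe_mul,
    mul_assoc]

/-- The fibre sum `∑_{l ∈ L/L'} f'(x l L')`, as a function of `x L ∈ 𝒢 ⧸ L`. [folklore] -/
def traceFun (f' : (𝒢 ⧸ L') → V) : (𝒢 ⧸ L) → V :=
  Quotient.lift (fun x : 𝒢 => ∑ m : L ⧸ L'.subgroupOf L, traceTerm (V := V) f' x m)
    fun x y hxy => by
      obtain ⟨l₀, rfl⟩ : ∃ l₀ : L, y = x * l₀ :=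
        ⟨⟨x⁻¹ * y, QuotientGroup.leftRel_apply.1 hxy⟩, by simp⟩
      simp_rw [traceTerm_mul]
      exact (Equiv.sum_comp (MulAction.toPerm l₀ : Equiv.Perm (L ⧸ L'.subgroupOf L)) _).symm

/-- Unfolding lemma. [folklore] -/
theorem traceFun_mk (f' : (𝒢 ⧸ L') → V) (x : 𝒢) :
    traceFun (L := L) (V := V) f' (x : 𝒢 ⧸ L) = ∑ m : L ⧸ L'.subgroupOf L, traceTerm (V := V) f' x m :=
  rfl

/-- The fibre sum as a `k`-linear map. [folklore] -/
def traceLinear : ((𝒢 ⧸ L') → V) →ₗ[k] ((𝒢 ⧸ L) → V) where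
  toFun := traceFun (L := L)
  map_add' f f' := by
    funext c
    induction c using QuotientGroup.induction_on with
    | H x =>
    rw [Pi.add_apply, traceFun_mk, traceFun_mk, traceFun_mk, ← Finset.sum_add_distrib]
    refine Finset.sum_congr rfl fun m _ => ?_
    induction m using QuotientGroup.induction_on with
    | H l => rfl
  map_smul' r f := by
    funext c
    induction c using QuotientGroup.induction_on with
    | H x =>
    rw [Pi.smul_apply, traceFun_mk, traceFun_mk, Finset.smul_sum]
    refine Finset.sum_congr rfl fun m _ => ?_
    induction m using QuotientGroup.induction_on with
    | H l => rfl

/-- The trace intertwines the twisted `Γ`-actions. [folklore] -/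
theorem traceLinear_coeffRepresentation (γ : Γ) (f' : (𝒢 ⧸ L') → V) :
    traceLinear (k := k) (L := L) (coeffRepresentation ι L' ρ γ f') =
      coeffRepresentation ι L ρ γ (traceLinear (k := k) (L := L) f') := by
  funext c
  induction c using QuotientGroup.induction_on with
  | H x =>
  change traceFun (L := L) (coeffRepresentation ι L' ρ γ f') (x : 𝒢 ⧸ L) =
    ρ γ (traceFun (L := L) f' ((ι γ)⁻¹ • (x : 𝒢 ⧸ L)))
  rw [MulAction.Quotient.smul_coe, smul_eq_mul, traceFun_mk, traceFun_mk, map_sum]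
  refine Finset.sum_congr rfl fun m _ => ?_
  induction m using QuotientGroup.induction_on with
  | H l =>
  rw [traceTerm_mk, traceTerm_mk, coeffRepresentation_apply, MulAction.Quotient.smul_coe,
    smul_eq_mul, mul_assoc]

/-- **The trace** `Fun(𝒢 ⧸ L', V) ⟶ Fun(𝒢 ⧸ L, V)`, `(tr f')(xL) = ∑_{l ∈ L/L'} f'(x l L')`, a
morphism of `Γ`-representations. [cite: ShimuraIATAF1971, Ch. 3, §3.1] -/
def traceHom : coeffRep ι L' ρ ⟶ coeffRep ι L ρ :=
  Rep.ofHom ⟨traceLinear (L := L), fun γ =>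
    LinearMap.ext fun f' => traceLinear_coeffRepresentation ι ρ γ f'⟩

/-- Unfolding lemma. [folklore] -/
theorem traceHom_hom_apply_mk (f' : (𝒢 ⧸ L') → V) (x : 𝒢) :
    (traceHom (L := L) ι ρ).hom f' (x : 𝒢 ⧸ L) =
      ∑ m : L ⧸ L'.subgroupOf L, traceTerm (V := V) f' x m := rfl

/-- **`trace (pull f) = [L : L'] • f`.** [cite: ShimuraIATAF1971, Ch. 3, §3.1] -/
theorem traceHom_pullbackHom_apply (f : (𝒢 ⧸ L) → V) :
    (traceHom (L := L) ι ρ).hom ((pullbackHom ι ρ h).hom f) = (L'.subgroupOf L).index • f := by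
  funext c
  induction c using QuotientGroup.induction_on with
  | H x =>
  rw [traceHom_hom_apply_mk, Pi.smul_apply]
  have hterm : ∀ m : L ⧸ L'.subgroupOf L,
      traceTerm (V := V) ((pullbackHom ι ρ h).hom f) x m = f (x : 𝒢 ⧸ L) := fun m => by
    induction m using QuotientGroup.induction_on with
    | H l =>
    rw [traceTerm_mk, pullbackHom_hom_apply]
    change f (((x * (l : 𝒢) : 𝒢)) : 𝒢 ⧸ L) = f (x : 𝒢 ⧸ L)
    rw [QuotientGroup.mk_mul_of_mem x l.2]
  rw [Finset.sum_congr rfl fun m _ => hterm m, Finset.sum_const, Finset.card_univ,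
    Subgroup.index_eq_card, Nat.card_eq_fintype_card]

/-- **`pullbackHom ≫ traceHom = [L : L'] • 𝟙`.** [cite: ShimuraIATAF1971, Ch. 3, §3.1] -/
theorem pullbackHom_comp_traceHom :
    pullbackHom ι ρ h ≫ traceHom (L := L) ι ρ = (L'.subgroupOf L).index • 𝟙 (coeffRep ι L ρ) := by
  refine Rep.hom_ext (Representation.IntertwiningMap.ext (LinearMap.ext fun f => ?_))
  change (traceHom (L := L) ι ρ).hom ((pullbackHom ι ρ h).hom f) =
    ((L'.subgroupOf L).index • 𝟙 (coeffRep ι L ρ) : coeffRep ι L ρ ⟶ coeffRep ι L ρ).hom f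
  rw [traceHom_pullbackHom_apply, Rep.nsmul_hom]
  rfl

/-! ### On cohomology -/

omit [(L'.subgroupOf L).FiniteIndex] in
/-- `Hⁿ(id, m • 𝟙) x = m • x`. [folklore] -/
private theorem map_nsmul_id_apply (A : Rep k Γ) (m n : ℕ) (x : groupCohomology A n) :
    (groupCohomology.map (MonoidHom.id Γ) (m • 𝟙 A) n).hom x = m • x := by
  induction m with
  | zero =>
    rw [zero_smul, zero_smul]
    change (HomologicalComplex.homologyMap ((groupCohomology.cochainsFunctor k Γ).map 0) n).hom x = 0
    rw [(groupCohomology.cochainsFunctor k Γ).map_zero, HomologicalComplex.homologyMap_zero]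
    rfl
  | succ m ih =>
    rw [add_smul, one_smul, add_smul, one_smul]
    change (HomologicalComplex.homologyMap ((groupCohomology.cochainsFunctor k Γ).map
      (m • 𝟙 A + 𝟙 _)) n).hom x = _
    rw [(groupCohomology.cochainsFunctor k Γ).map_add, HomologicalComplex.homologyMap_add,
      ModuleCat.hom_add, LinearMap.add_apply]
    change (groupCohomology.map (MonoidHom.id Γ) (m • 𝟙 A) n).hom x +
      (groupCohomology.map (MonoidHom.id Γ) (𝟙 A) n).hom x = _
    rw [ih, groupCohomology.map_id]
    rfl

/-- **`H^q(trace) (H^q(pull) x) = [L : L'] • x`** on `H^q(S_L, Ṽ)`. [cite: ShimuraIATAF1971, Ch. 3, §3.1] -/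
theorem traceMap_pullbackMap_apply (q : ℕ) (x : cohomology ι L ρ q) :
    (groupCohomology.map (MonoidHom.id Γ) (traceHom (L := L) ι ρ) q).hom
        ((pullbackMap ι ρ h q).hom x) = (L'.subgroupOf L).index • x := by
  have hc := congrArg (fun φ => (groupCohomology.map (MonoidHom.id Γ) φ q).hom x)
    (pullbackHom_comp_traceHom ι ρ h)
  change (groupCohomology.map (MonoidHom.id Γ) (pullbackHom ι ρ h ≫ traceHom (L := L) ι ρ) q).hom x =
    (groupCohomology.map (MonoidHom.id Γ) ((L'.subgroupOf L).index • 𝟙 (coeffRep ι L ρ)) q).hom x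
    at hc
  rw [groupCohomology.map_id_comp, ModuleCat.hom_comp, LinearMap.comp_apply, map_nsmul_id_apply]
    at hc
  exact hc

/-- **Pull-back to a smaller level is injective on `H^q`** as soon as the index `[L : L']` acts
injectively on `H^q(S_L, Ṽ)` (e.g. is invertible in `k`). [cite: Harder1987, §1] -/
theorem pullbackMap_injective (q : ℕ)
    (hreg : ∀ x : cohomology ι L ρ q, (L'.subgroupOf L).index • x = 0 → x = 0) :
    Function.Injective (pullbackMap ι ρ h q).hom := by
  intro x y hxy
  have hc := congrArg (groupCohomology.map (MonoidHom.id Γ) (traceHom (L := L) ι ρ) q).hom hxy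
  rw [traceMap_pullbackMap_apply, traceMap_pullbackMap_apply] at hc
  have h0 : (L'.subgroupOf L).index • (x - y) = 0 := by rw [smul_sub, hc, sub_self]
  exact sub_eq_zero.1 (hreg _ h0)

end Trace

/-! ### Hecke compatibility -/

/-- **Hecke operators commute with pull-back** (coefficient representations) when
`𝒢 ⧸ L' → 𝒢 ⧸ L` maps `L' g L' / L'` bijectively onto `L g L / L`. [cite: ShimuraIATAF1971, Ch. 3, Prop. 3.1] -/
theorem heckeRepHom_comp_pullbackHom (h : L' ≤ L) (g : 𝒢)
    (hbij : Set.BijOn (Subgroup.quotientMapOfLE h) (ArithmeticQuotient.doubleCosetQuot L' g)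
      (ArithmeticQuotient.doubleCosetQuot L g))
    (hfin : (ArithmeticQuotient.doubleCosetQuot L g).Finite) :
    heckeRepHom ι L ρ g ≫ pullbackHom ι ρ h = pullbackHom ι ρ h ≫ heckeRepHom ι L' ρ g :=
  Rep.hom_ext (Representation.IntertwiningMap.ext (LinearMap.ext fun f =>
    (ArithmeticQuotient.heckeFun_comp_quotientMapOfLE (k := k) h g hbij hfin f).symm))

/-- **Hecke operators commute with pull-back on `H^q`**: `pull (T^L_g x) = T^{L'}_g (pull x)`.
[cite: ShimuraIATAF1971, Ch. 3, Prop. 3.1] [cite: Harder1987, §1] -/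
theorem pullbackMap_heckeEnd_apply (h : L' ≤ L) (g : 𝒢)
    (hbij : Set.BijOn (Subgroup.quotientMapOfLE h) (ArithmeticQuotient.doubleCosetQuot L' g)
      (ArithmeticQuotient.doubleCosetQuot L g))
    (hfin : (ArithmeticQuotient.doubleCosetQuot L g).Finite) (q : ℕ) (x : cohomology ι L ρ q) :
    (pullbackMap ι ρ h q).hom (heckeEnd ι L ρ g q x) = heckeEnd ι L' ρ g q ((pullbackMap ι ρ h q).hom x) := by
  change (heckeOperator ι L ρ g q ≫ pullbackMap ι ρ h q).hom x =
    (pullbackMap ι ρ h q ≫ heckeOperator ι L' ρ g q).hom x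
  rw [heckeOperator, heckeOperator, pullbackMap, ← groupCohomology.map_id_comp,
    heckeRepHom_comp_pullbackHom ι ρ h g hbij hfin, groupCohomology.map_id_comp]

/-- Hence an eigenclass of `T^L_g` pulls back to an eigenclass of `T^{L'}_g` with the same
eigenvalue. [folklore] -/
theorem heckeEnd_pullbackMap_of_eigen (h : L' ≤ L) (g : 𝒢)
    (hbij : Set.BijOn (Subgroup.quotientMapOfLE h) (ArithmeticQuotient.doubleCosetQuot L' g)
      (ArithmeticQuotient.doubleCosetQuot L g))
    (hfin : (ArithmeticQuotient.doubleCosetQuot L g).Finite) (q : ℕ) {x : cohomology ι L ρ q}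
    {a : k} (hx : heckeEnd ι L ρ g q x = a • x) :
    heckeEnd ι L' ρ g q ((pullbackMap ι ρ h q).hom x) = a • (pullbackMap ι ρ h q).hom x := by
  rw [← pullbackMap_heckeEnd_apply ι ρ h g hbij hfin, hx, map_smul]

end TwistedQuotient

end Literature.NumberTheory.Automorphic
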